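import Summits.NavierStokesRegularity.NavierStokesRegularity.Theses.ExtremiserTransience
import Literature.Analysis.FluidPDE.BlowupAncientSolution
import Literature.Analysis.FluidPDE.NSBoundedMildOseen
import Literature.Analysis.FluidPDE.MildSolution
import Literature.Analysis.FluidPDE.VorticityCalculus
import Summits.NavierStokesRegularity.NavierStokesRegularity.Theorems.ExtremiserTransienceKStarAttainedContact
import Summits.NavierStokesRegularity.NavierStokesRegularity.Theorems.ExtremiserTransienceNearExtremalTransienceSharpConstant
import HarnessLib.Audit

/-!
# Crux `NearExtremalTransience` (stmt-NavierStokesRegularity-21883) — LINE «campbell_extremiser» rev 2 (ns-idea-10 g4, lens «rescuer», LINE 2)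

TARGET DECIDED (by name, kernel-checked `NearExtremalTransiencePerFlow_of`): `Theses.ExtremiserTransience.NearExtremalTransiencePerFlow`
(stmt-26567, the binder `hT` of the route's `closes`).  21883 (universal θ) is NOT reached.  No summit is proved by a line.

REV 2 = THE PRE-DECLARED ALIGNMENT (card rev 1 §«Tree overlap», §«Pre-declared variant»).  At 2026-08-28T11:36Z the route file gained
ns-idea-5's LINE g5-α items `LocalNearPlateauStability` (27676) ⇒ `PlateauTransfer` (27677) ⇒ contradiction with
`PlateauAncientRigidity` (27678).  This line shares the END-GAME and now CITES IT BY NAME (`stub_plateauAncientRigidity :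
PlateauAncientRigidity`, BC4: cite, do not restate) and differs in the LEVER that makes the tangent plateau EXACT: not a δ-uniform
STABILITY inequality for near-maximisers transported along deterministic KNSS zooms (27676 + 27677), but the EXISTENCE OF A
GENERALISED EXACT MAXIMISER — the |ω|²-Palm / Campbell LAW of the blow-up (compactness of laws + upper semicontinuity of the ratio of
expectations; `stub_campbellWindowExtraction`) — and the EULER–LAGRANGE theory of exact maximisers among twisted-stationary laws
(`stub_windowContact`).  In one sentence: S1 ∧ S2 prove the CONSEQUENT of `PlateauTransfer` WITHOUT `LocalNearPlateauStability`.

THE DEATH DODGED (rescuer, unchanged from rev 1): every deterministic extraction dies because the limit leaves the admissible class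
(L²-falsity of blow-up limits; copy-invariance / N(t) → ∞ cells / crystals — ns-idea-5 KEY RISK 2026-08-28T10:36Z; local-limit
vacuity).  Palm centring at a |ω|²-typical point makes the limit LAW always exist, keeps efficiency meaningful (ratio of expectations
of pointwise densities) and usc, and turns copies and crystals into stationarity.  Rev 2 centres in SPACE–TIME: the reference slice is
the time-0 slice of a random ancient field 𝒲, and WINDOW EXTREMALITY (from ¬26567 with k := the efficiency itself: the log-averages
of R² have limsup κ⋆², so there are log-windows of any length in which all but a vanishing fraction of times are near-efficient) makes
the τ-slice laws Campbell-extremal, under equivalent reweightings P_τ ≪ P, for a positive-measure set of times τ < 0.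

LABEL (critic V40 P1, verbatim class): «TYPED PROGRAM, not a near-proof: 2 new open stubs (S1 XL, S2 L) + the shared open item 27678 (L/XL); per
flow; decides 26567 only modulo S1 ∧ S2 ∧ 27678».

REV 3.7 (13:05Z): S2c split into its analytic core `stub_cutoffAveraging` (`3(E f)² = 2κ⋆²M²(E g)` from a.s. EL for all curls; M/L, thin-law
risk) and `homogeneityContradiction` PROVED from it with the tree's `sharpDepletion_gt` (κ⋆ > 13/200).  STUBS: S1a, S2a, S2c `stub_cutoffAveraging`, S3′ (4).

REV 3.6 (12:58Z) — ALIGNMENT DIVIDEND: the end-game `PlateauSliceRigidity` (27823) asks only for a continuous Oseen/Type-I ancient field with ONE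
plateau slice — no `IsKNSSBlowupLimit` sup-normalisation — so the ergodic selection (S1b) and the sup-normalisation (S1c), which existed solely to
package realisations as KNSS limits for 27678, are DELETED together with `IsWindowCampbellExtremal` and `gridSup`; critic V42 P7 is thereby discharged at
the root (no invariant-functional clause remains anywhere; S2c needs no ergodicity, see its note).  `sliceContact` and the glue are stated for
pre-window laws (`IsPreWindowLaw`, produced by S1a).  STUBS: S1a `stub_preLawExtraction`, S2a `stub_pathwiseEL`, S2c `stub_homogeneityContradiction`,
S3′ `stub_plateauSliceRigidity` (= 27823) — 4 sorries; proved in-file: `densityExtension` (S2b), `sliceContact` (S2′), glue, 27823 ⇒ 27678, composition.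

REV 3.5 (12:52Z, critic V42 P7 repair (β), superseded by 3.6): the ergodic selection S1b concludes on the NAMED functional `gridSup` (rational-grid space–time sup:
product-measurable, = the true sup and shift-invariant on continuous realisations), a.s. constant > 0 under the selected law; S1c consumes exactly that;
the vacuous «∀ measurable shift-invariant A» clauses are gone (also from S2c, where ergodicity is not needed).  Stubs: S1a, S1b, S1c, S2a, S2c, S3′ (6).

REV 3.4 (12:50Z): S2′ `sliceContact` is now DERIVED (kernel-checked) from S2a `stub_pathwiseEL` + S2b `densityExtension` (PROVED: the tree's
`exists_density` continuity argument) + S2c `stub_homogeneityContradiction` — the random-field version of `KStar.interior_contact_nonempty`; (rev 3.4 only: an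
ergodic clause in the window law, removed in 3.5).  Stubs: S1a, S1b, S1c, S2a, S2c, S3′ (6).

REV 3.2 (critic V41 P6 «follow if ns-idea-5's items are restated», 12:45Z): the route file was rewritten at 12:27Z — 27677 is SPLIT into
`PlateauSliceTransfer` (27822) + `PlateauSliceRigidity` (27823) + glue (27824).  ALIGNED: the end-game is now S3′ `stub_plateauSliceRigidity :
PlateauSliceRigidity` (27823 BY NAME; one slice, no curl, no time set), which lets the variational crux WEAKEN to S2′ `stub_sliceContact` (one
plateau slice with positive probability); `plateauAncientRigidity_of_slice : PlateauSliceRigidity → PlateauAncientRigidity` is PROVED in-file as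
the cross-check with the rev ≤ 3 end-game 27678; rev-3 S2 `stub_windowContact` / S3 `stub_plateauAncientRigidity` SUPERSEDED (statements kept in
the S2′ docstring / git).

REV 3 (critic V41 P2, 12:25Z): the XL extraction stub is SPLIT into three typed, separately attackable stubs with a kernel-checked recomposition —
S1a `stub_preLawExtraction` (L/XL: Palm pre-law; internal estimates typed in the first-lemma file), S1b `stub_ergodicSelection` (L: invariant
functionals a.s. constant, extremality kept — via no-gain), S1c `stub_supNormalise` (M/L: deterministic parabolic rescaling ⇒ IsKNSSBlowupLimit
realisations); `stub_campbellWindowExtraction` is now a THEOREM from the three.  Rev 1 (c6b4c53557f4) and rev 2 (6f6aa6975b49/fabdb62573de) SUPERSEDED,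
kept in git for the record.

SKELETON OF RECORD (rev 3.6): interfaces `IsCampbellExtremal` (slice law: twisted-stationary generalised extremiser) and `IsPreWindowLaw`
(space–time law, window-extremal); S1a `stub_preLawExtraction` (THE RESCUER CRUX, L/XL: a flow violating the 26567 conclusion ⇒ a pre-window law, by
|ω|²-Palm centring + tightness + Fatou in time + no-gain/usc; first lemmas typed in `Lines/campbell_extremiser_el.lean`) · S2a `stub_pathwiseEL` (L: an
extremal slice law satisfies, a.s., the Euler–Lagrange identity with the LAW's constants off the contact set) · S2b `densityExtension` (PROVED) · S2c
`stub_cutoffAveraging` (M/L: a.s. EL for all curls averages, by the divergence-free cut-off and Campbell, to 3(E f)² = 2κ⋆²M²(E g)) · `homogeneityContradiction`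
(PROVED: absurd against extremality, E g > 0 and κ⋆ > 0) · S2′ `sliceContact` (PROVED from
S2a–c: positive probability of an exact top-speed plateau slice in the window) · glue `sliceElement_of_window` (PROVED) · S3′ `stub_plateauSliceRigidity`
(= route item 27823 BY NAME; `plateauAncientRigidity_of_slice : 27823 → 27678` PROVED) · composition `NearExtremalTransiencePerFlow_of` (no sorry) decides
26567 BY NAME modulo S1a ∧ S2a ∧ S2c ∧ 27823 (S2c = `stub_cutoffAveraging`).  HONEST LIMITS: per flow only; S1a is L/XL; S2a contains «no gain from laws» (shared first lemma
`stub_noGainFromLaws`); S2c's residual risk is THIN laws; no summit, 26567, 21883, 27823 or 27678 is proved here.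
Retired: rev 1 `IsBoundedOseenAncient`, `stub_ancientSpeedRigidity`, `stub_constantSpeedLiouville`; rev 2/3 `stub_windowContact`, `stub_plateauAncientRigidity`
(27678 by name), `IsWindowCampbellExtremal`; rev 3–3.5 `stub_ergodicSelection`, `stub_supNormalise`, `stub_campbellWindowExtraction`, `gridSup`; rev 3.2/3.3
`stub_sliceContact` (now a theorem).
-/

noncomputable section

open Set MeasureTheory Filter Topology
open scoped InnerProductSpace RealInnerProductSpace ENNReal ContDiff
open Literature.Analysis.FluidPDE

set_option linter.dupNamespace false

namespace Summit.NavierStokesRegularity.NavierStokesRegularity.Cruxes.NearExtremalTransience.CampbellExtremiser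

open Summit.NavierStokesRegularity.NavierStokesRegularity.Theses.ExtremiserTransience

/-- INTERFACE 2 (posited object; existence is `stub_campbellExtraction`).  A GENERALISED (CAMPBELL) EXTREMISER of the depletion
functional: a probability space `(Ω, P)` and a jointly measurable random field `V : Ω → ℝ³ → ℝ³` such that
* a.s. the field is smooth, divergence-free, bounded by `M > 0`, with vorticity `ω(0) ≠ 0` AT THE ORIGIN (Palm normalisation),
  and all derivatives are bounded uniformly in the sample (compact hull); `M` is the SHARP amplitude of the law (every level `M' < M`
  is exceeded somewhere with positive probability — so stub 2 cannot be falsified by padding `M`; added rev 1);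
* CAMPBELL–MECKE TWISTED STATIONARITY: for every shift `a` and every bounded measurable functional `Φ` of the field,
  `E[Φ(V(· + a))] = E[Φ(V) · |ω(−a)|²/|ω(0)|²]` (the law is the |ω(0)|²-weighting of a translation-invariant σ-finite measure;
  for a single L² field `v` it is `a ↦ v(· + a)` under `|ω(a)|²da/Z`), the density ratios being integrable;
* EFFICIENCY ≥ κ⋆ as a ratio of expectations of pointwise densities at the origin:
  `|E[⟨ω, Dv ω⟩/|ω|²(0)]| ≥ κ⋆ · M · √(E[|∇ω|²_F/|ω|²(0)])`, with both densities integrable and the palinstrophy density positive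
  (for a single L² field this is exactly `|J| ≥ κ⋆ M √Z √P`, since `E[…] = J/Z` and `P/Z`).
κ⋆ is the tree literal `sInf {κ | sharp inequality on the L² class V}` of `Theses.ExtremiserTransience`.  MEASURABILITY CONVENTION (critic V40 P2): `Measurable V`, `Measurable (uncurry V)` and `Measurable Φ` are with respect to
the PRODUCT (cylinder) σ-algebra `MeasurableSpace.pi` on `ℝ³ → ℝ³` (what Lean elaborates here) and the Borel σ-algebras on `Ω`-products.  Every
functional the line's proofs use is cylinder-measurable on the support (smooth realisations with uniform `C^k` bounds = a compact metrisable hull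
in `C^∞_loc`): point evaluations (by definition), derivatives at points (limits of difference quotients of evaluations along a fixed countable
sequence), local `C^k` functionals and window integrals of continuous realisations (limits of Riemann sums of evaluations), indicator of
`{∃ x, M' < ‖V x‖}` (= a countable union over rational `x` by continuity).  So S1's «law» and S2's variations speak about the same σ-algebra. -/
def IsCampbellExtremal {Ω : Type*} [MeasurableSpace Ω] (P : Measure Ω)
    (V : Ω → EuclideanSpace ℝ (Fin 3) → EuclideanSpace ℝ (Fin 3)) (M : ℝ) : Prop :=
  IsProbabilityMeasure P ∧ 0 < M ∧ Measurable V ∧ Measurable (Function.uncurry V) ∧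
  (∀ᵐ w ∂P, ContDiff ℝ (⊤ : ℕ∞) (V w) ∧ VectorCalculus.IsDivFree (V w) ∧ (∀ x, ‖V w x‖ ≤ M) ∧ curl (V w) 0 ≠ 0) ∧
  (∀ M' : ℝ, M' < M → 0 < P {w | ∃ x, M' < ‖V w x‖}) ∧
  (∃ Bk : ℕ → ℝ, ∀ᵐ w ∂P, ∀ (k : ℕ) (x : EuclideanSpace ℝ (Fin 3)), ‖iteratedFDeriv ℝ k (V w) x‖ ≤ Bk k) ∧
  (∀ a : EuclideanSpace ℝ (Fin 3), Integrable (fun w => ‖curl (V w) (-a)‖ ^ 2 / ‖curl (V w) 0‖ ^ 2) P) ∧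
  (∀ (a : EuclideanSpace ℝ (Fin 3)) (Φ : (EuclideanSpace ℝ (Fin 3) → EuclideanSpace ℝ (Fin 3)) → ℝ),
      Measurable Φ → (∀ v, |Φ v| ≤ 1) →
      ∫ w, Φ (fun y => V w (y + a)) ∂P = ∫ w, Φ (V w) * (‖curl (V w) (-a)‖ ^ 2 / ‖curl (V w) 0‖ ^ 2) ∂P) ∧
  Integrable (fun w => ⟪curl (V w) 0, fderiv ℝ (V w) 0 (curl (V w) 0)⟫_ℝ / ‖curl (V w) 0‖ ^ 2) P ∧
  Integrable (fun w => frobeniusNormSq (fderiv ℝ (curl (V w)) 0) / ‖curl (V w) 0‖ ^ 2) P ∧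
  0 < ∫ w, frobeniusNormSq (fderiv ℝ (curl (V w)) 0) / ‖curl (V w) 0‖ ^ 2 ∂P ∧
  sInf {κ : ℝ | ∀ (v : EuclideanSpace ℝ (Fin 3) → EuclideanSpace ℝ (Fin 3)) (M B : ℝ), ContDiff ℝ (⊤ : ℕ∞) v →
      Literature.Analysis.FluidPDE.VectorCalculus.IsDivFree v → (∀ x, ‖v x‖ ≤ M) → (∀ x, ‖fderiv ℝ v x‖ ≤ B) →
      (∫⁻ x, ‖iteratedFDeriv ℝ 0 v x‖ₑ ^ 2 < ⊤) → (∫⁻ x, ‖iteratedFDeriv ℝ 1 v x‖ₑ ^ 2 < ⊤) →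
      (∫⁻ x, ‖iteratedFDeriv ℝ 2 v x‖ₑ ^ 2 < ⊤) →
      |∫ x, ⟪Literature.Analysis.FluidPDE.curl v x, fderiv ℝ v x (Literature.Analysis.FluidPDE.curl v x)⟫_ℝ| ≤
        κ * M * Real.sqrt (∫ x, ‖Literature.Analysis.FluidPDE.curl v x‖ ^ 2) *
          Real.sqrt (∫ x, Literature.Analysis.FluidPDE.frobeniusNormSq (fderiv ℝ (Literature.Analysis.FluidPDE.curl v) x))}
    * M * Real.sqrt (∫ w, frobeniusNormSq (fderiv ℝ (curl (V w)) 0) / ‖curl (V w) 0‖ ^ 2 ∂P) ≤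
    |∫ w, ⟪curl (V w) 0, fderiv ℝ (V w) 0 (curl (V w) 0)⟫_ℝ / ‖curl (V w) 0‖ ^ 2 ∂P|

/-- INTERFACE 3 (posited object; existence is `stub_preLawExtraction`).  A WINDOW-EXTREMAL SPACE–TIME CAMPBELL LAW («pre-window law»; rev 3,
critic V41 P2): a probability space `(Ω, P)` and a jointly measurable random ANCIENT field `𝒲 : Ω → ℝ → ℝ³ → ℝ³` such that a.s. the realisation is a
bounded ancient mild solution with measurable smooth slices, the Oseen–Duhamel identity on `(−∞,0)` and a backward Type-I bound `√(−t)‖𝒲 t x‖ ≤ K`,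
with non-zero vorticity at the reference space–time point `(τ₀, 0)`; PLUS the SPACE–TIME Campbell–Mecke identity twisted at the reference time `τ₀ < 0`
(spatial shifts act on the whole space–time field, weight `|ω(τ₀,−a′)|²/|ω(τ₀,0)|²`); PLUS WINDOW EXTREMALITY: for every time τ of a positive-measure set
`E ⊆ (a, b)`, `b ≤ 0`, some measure `P_τ ≪ P` makes the τ-slice a generalised (Campbell) extremiser `IsCampbellExtremal P_τ (fun w => 𝒲 w τ) M_τ`.
REV 3.6: this is ALL the composition needs — the end-game `PlateauSliceRigidity` (27823) asks for no sup-normalisation / `IsKNSSBlowupLimit` packaging,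
so the ergodic selection (former S1b) and the sup-normalisation (former S1c, with `IsWindowCampbellExtremal`) are gone. -/
def IsPreWindowLaw {Ω : Type*} [MeasurableSpace Ω] (P : Measure Ω)
    (𝒲 : Ω → ℝ → EuclideanSpace ℝ (Fin 3) → EuclideanSpace ℝ (Fin 3)) (τ₀ a b : ℝ) : Prop :=
  IsProbabilityMeasure P ∧ a < b ∧ b ≤ 0 ∧ τ₀ < 0 ∧
  Measurable (fun q : Ω × ℝ × EuclideanSpace ℝ (Fin 3) => 𝒲 q.1 q.2.1 q.2.2) ∧
  (∀ᵐ w ∂P, IsBoundedAncientMildSolution 1 (𝒲 w) ∧ (∀ t : ℝ, t < 0 → AEStronglyMeasurable (𝒲 w t) volume) ∧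
      ContDiffOn ℝ (⊤ : ℕ∞) (Function.uncurry (𝒲 w)) (Set.Iio 0 ×ˢ Set.univ) ∧
      (∀ s t : ℝ, s < t → t < 0 → ∀ x, 𝒲 w t x = heatFlow (𝒲 w s) (t - s) x - oseenDuhamel 1 s (𝒲 w) (𝒲 w) t x) ∧
      (∃ K : ℝ, ∀ t : ℝ, t < 0 → ∀ x, Real.sqrt (-t) * ‖𝒲 w t x‖ ≤ K) ∧ curl (𝒲 w τ₀) 0 ≠ 0) ∧
  (∀ a' : EuclideanSpace ℝ (Fin 3), Integrable (fun w => ‖curl (𝒲 w τ₀) (-a')‖ ^ 2 / ‖curl (𝒲 w τ₀) 0‖ ^ 2) P) ∧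
  (∀ (a' : EuclideanSpace ℝ (Fin 3)) (Φ : (ℝ → EuclideanSpace ℝ (Fin 3) → EuclideanSpace ℝ (Fin 3)) → ℝ),
      Measurable Φ → (∀ W, |Φ W| ≤ 1) →
      ∫ w, Φ (fun t y => 𝒲 w t (y + a')) ∂P = ∫ w, Φ (𝒲 w) * (‖curl (𝒲 w τ₀) (-a')‖ ^ 2 / ‖curl (𝒲 w τ₀) 0‖ ^ 2) ∂P) ∧
  (∃ E : Set ℝ, E ⊆ Set.Ioo a b ∧ 0 < volume E ∧
      ∀ τ ∈ E, ∃ (Pτ : Measure Ω) (Mτ : ℝ), Pτ ≪ P ∧ IsCampbellExtremal Pτ (fun w => 𝒲 w τ) Mτ)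

/-- **stub 1a (THE RESCUER CRUX, extraction proper; rank 2, size L/XL — rev 3 split of the XL stub, critic V41 P2).** CAMPBELL PRE-LAW EXTRACTION:
the flow gives a PRE-LAW (`IsPreWindowLaw`: no sup-normalisation yet, space–time Campbell identity at a reference time τ₀).  Its internal estimates
are typed separately in `Lines/campbell_extremiser_el.lean`: `stub_palmTightness` (leakage), `stub_windowFatou` (positive-measure extremal τ-set in
the limit), `stub_retwistAbsCont` (re-twisting to time τ; P_τ ∼ P); compactness/Prokhorov, usc and the KNSS identification are routine/Literature.
ORIGINAL rev-2 docstring of the unsplit stub follows.  CAMPBELL WINDOW EXTRACTION.  A Type-I singular classical Leray–Hopf flow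
violating the per-flow near-extremal transience conclusion carries a window-extremal space–time Campbell law.  Route: (1) ¬conclusion
with `k := R` (the efficiency itself is an admissible coefficient) gives `limsup` of the log-averages of `R²` equal to `κ⋆²`, hence
log-time windows `[s, s+L]` of any length in which the non-(κ⋆−ε)-efficient times have log-fraction `< ε`; the landed scale lock
(`PerFlow.scaleLock_at_nearEfficient_times`) and Leray's lower rate hold along them; (2) recentre parabolically at the window's final
time `tₙ` and at a random point `c ~ |ω(tₙ,c)|²dc/Z(tₙ)`; Type-I bounds make the laws of the recentred rescaled FLOWS tight on a compact
hull of ancient fields (uniform smooth bounds on `(−∞, 0) × ℝ³` compacta), so a limit law exists (Prokhorov) whatever the geometry of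
the slices (one bump, N → ∞ bumps, a crystal); (3) the Campbell–Mecke identity at the reference time passes to the limit; at another
window time τ the |ω(τ,·)|²-reweighting `P_τ` is `≪ P` (analytic realisations: `Q{ω(τ,0) = 0} = 0` for the stationary hull measure Q by
Campbell, and ω(0,·) ≡ 0 forces a constant realisation by harmonic Liouville + backward uniqueness, a Q-null event) and makes the τ-slice
twisted-stationary; usc of the ratio of expectations gives efficiency ≥ κ⋆ at every τ of the (positive-measure) limit set of efficient
times; (4) KNSS local convergence identifies a.e. realisation as a bounded Oseen-mild ancient field with backward Type-I decay, and the
per-realisation normalisation by its space–time sup (a shift-invariant functional, so twisted stationarity survives fibrewise) makes it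
an `IsKNSSBlowupLimit`.  FIRST LEMMA TYPED SEPARATELY (V40 P3): `stub_palmTightness` in `Lines/campbell_extremiser_el.lean` (static no-leakage form, with
its concrete failure mode and the two fall-backs: flow form along locked slices / conditioning away constant realisations).  Why it might fail:
vorticity-mass leakage (tightness of the Palm normalisation |ω(0,0)| away from 0), or loss
of efficiency in the limit at a.e. window time because near-efficiency along the flow is only in log-MEAN (a positive-measure set of
exactly-extremal times needs the usc argument uniformly on a set of times, i.e. Fatou in τ).  [sources: KochNadirashviliSereginSverak2009
(§4–6), SereginSverak2009, LastPenrose2017 (Ch. 9 Palm, Mecke eq.), Kallenberg2021, Lions1984, tree PerFlow.scaleLock_at_nearEfficient_times,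
efficientTimes_logDensity_of_not_perFlow, Theses items 27677 (sibling bookkeeping), 26568] -/
theorem stub_preLawExtraction :
    ∀ (C ν T : ℝ), 0 < C → 0 < ν → 0 < T →
      ∀ (u : ℝ → EuclideanSpace ℝ (Fin 3) → EuclideanSpace ℝ (Fin 3)) (p : ℝ → EuclideanSpace ℝ (Fin 3) → ℝ),
        IsClassicalNSSolutionOn (Set.Ico 0 T) ν 0 u p → IsLerayHopfOn T ν 0 (u 0) u → HasRapidSpatialDecay (u 0) →
        (∀ᶠ t in 𝓝[<] T, ∀ x, Real.sqrt (T - t) * ‖u t x‖ ≤ C * Real.sqrt ν) →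
        ¬ HasSmoothExtensionPast ν 0 u T →
        ¬ (∃ θ : ℝ, 0 ≤ θ ∧ θ < 1 ∧ ∀ κ : ℝ,
            (∀ (v : EuclideanSpace ℝ (Fin 3) → EuclideanSpace ℝ (Fin 3)) (M B : ℝ), ContDiff ℝ (⊤ : ℕ∞) v →
              Literature.Analysis.FluidPDE.VectorCalculus.IsDivFree v → (∀ x, ‖v x‖ ≤ M) → (∀ x, ‖fderiv ℝ v x‖ ≤ B) →
              (∫⁻ x, ‖iteratedFDeriv ℝ 0 v x‖ₑ ^ 2 < ⊤) → (∫⁻ x, ‖iteratedFDeriv ℝ 1 v x‖ₑ ^ 2 < ⊤) →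
              (∫⁻ x, ‖iteratedFDeriv ℝ 2 v x‖ₑ ^ 2 < ⊤) →
              |∫ x, ⟪Literature.Analysis.FluidPDE.curl v x, fderiv ℝ v x (Literature.Analysis.FluidPDE.curl v x)⟫_ℝ| ≤
                κ * M * Real.sqrt (∫ x, ‖Literature.Analysis.FluidPDE.curl v x‖ ^ 2) *
                  Real.sqrt (∫ x, Literature.Analysis.FluidPDE.frobeniusNormSq (fderiv ℝ (Literature.Analysis.FluidPDE.curl v) x))) →
            ∃ t₁ ∈ Set.Ico 0 T, ∃ (k : ℝ → ℝ) (B : ℝ), Measurable k ∧ (∀ τ, 0 ≤ k τ ∧ k τ ≤ 1) ∧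
              (∀ t ∈ Set.Ico t₁ T, ∀ M : ℝ, (∀ x, ‖u t x‖ ≤ M) →
                |∫ x, ⟪Literature.Analysis.FluidPDE.curl (u t) x, fderiv ℝ (u t) x (Literature.Analysis.FluidPDE.curl (u t) x)⟫_ℝ| ≤
                  k t * M * Real.sqrt (∫ x, ‖Literature.Analysis.FluidPDE.curl (u t) x‖ ^ 2) *
                    Real.sqrt (∫ x, Literature.Analysis.FluidPDE.frobeniusNormSq (fderiv ℝ (Literature.Analysis.FluidPDE.curl (u t)) x))) ∧
              (∀ t ∈ Set.Ico t₁ T, ∫ τ in t₁..t, k τ ^ 2 / (T - τ) ≤ (θ * κ) ^ 2 * Real.log ((T - t₁) / (T - t)) + B)) →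
        ∃ (Ω : Type) (_ : MeasurableSpace Ω) (P : Measure Ω)
          (𝒲 : Ω → ℝ → EuclideanSpace ℝ (Fin 3) → EuclideanSpace ℝ (Fin 3)) (τ₀ a b : ℝ),
          IsPreWindowLaw P 𝒲 τ₀ a b := by
  sorry

/-! ### S2′ SLICE CONTACT — rev 3.4: DERIVED from S2a + S2b (proved) + S2c, the random-field version of the tree's
`KStar.interior_contact_nonempty`.  The former «E-plateau risk» dissolves into a dichotomy at an extremal time τ: either the slice law `P_τ ∼ P`
charges realisations with a plateau (⇒ S2′), or `P_τ`-a.s. the contact set is Lebesgue-null, hence has empty interior, the pathwise Euler–Lagrange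
identity (S2a, with the LAW's constants) extends to all curls (S2b, the tree's `exists_density` continuity argument, PROVED below) and the
divergence-free cut-off tested against it gives the homogeneity absurdity `3(E f)² = 2(E f)²` for an ergodic law (S2c). -/

/-- The tree's first variation of `J` (cf. `KStar.firstVariation_eq_zero_offContact`), as a function of the field and the test field. -/
def J1 (v φ : EuclideanSpace ℝ (Fin 3) → EuclideanSpace ℝ (Fin 3)) : ℝ :=
  ∫ x, (⟪curl φ x, fderiv ℝ v x (curl v x)⟫_ℝ + ⟪curl v x, fderiv ℝ φ x (curl v x)⟫_ℝ + ⟪curl v x, fderiv ℝ v x (curl φ x)⟫_ℝ)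

/-- Half the first variation of the enstrophy `Z`. -/
def A1 (v φ : EuclideanSpace ℝ (Fin 3) → EuclideanSpace ℝ (Fin 3)) : ℝ :=
  ∫ x, ⟪curl v x, curl φ x⟫_ℝ

/-- Half the first variation of the palinstrophy `W`. -/
def C1 (v φ : EuclideanSpace ℝ (Fin 3) → EuclideanSpace ℝ (Fin 3)) : ℝ :=
  ∫ x, ∑ i, ⟪fderiv ℝ (curl v) x (EuclideanSpace.basisFun (Fin 3) ℝ i), fderiv ℝ (curl φ) x (EuclideanSpace.basisFun (Fin 3) ℝ i)⟫_ℝ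

/-- PATHWISE EULER–LAGRANGE IDENTITY of a realisation `v` with the LAW's constants `ef = E f` («J/Z»), `eg = E g` («W/Z»), tested — in CURL FORM, as in
the tree's `interior_contact_nonempty` — against `curl η` for smooth compactly supported potentials `η` supported in the set `S` (`S = {‖v‖ < M}`:
off the contact set; `S = univ`: everywhere):
`ef · J₁(φ) = κ⋆² M² (eg · a₁(φ) + c₁(φ))` — the deterministic identity of `KStar.firstVariation_eq_zero_offContact` divided by `Z`. -/
def PathwiseEL (v : EuclideanSpace ℝ (Fin 3) → EuclideanSpace ℝ (Fin 3)) (M ef eg : ℝ) (S : Set (EuclideanSpace ℝ (Fin 3))) : Prop :=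
  ∀ η : EuclideanSpace ℝ (Fin 3) → EuclideanSpace ℝ (Fin 3), ContDiff ℝ ∞ η → HasCompactSupport η → tsupport η ⊆ S →
      ef * J1 v (curl η) = (sInf {κ : ℝ | ∀ (v : EuclideanSpace ℝ (Fin 3) → EuclideanSpace ℝ (Fin 3)) (M B : ℝ), ContDiff ℝ (⊤ : ℕ∞) v →
      Literature.Analysis.FluidPDE.VectorCalculus.IsDivFree v → (∀ x, ‖v x‖ ≤ M) → (∀ x, ‖fderiv ℝ v x‖ ≤ B) →
      (∫⁻ x, ‖iteratedFDeriv ℝ 0 v x‖ₑ ^ 2 < ⊤) → (∫⁻ x, ‖iteratedFDeriv ℝ 1 v x‖ₑ ^ 2 < ⊤) →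
      (∫⁻ x, ‖iteratedFDeriv ℝ 2 v x‖ₑ ^ 2 < ⊤) →
      |∫ x, ⟪Literature.Analysis.FluidPDE.curl v x, fderiv ℝ v x (Literature.Analysis.FluidPDE.curl v x)⟫_ℝ| ≤
        κ * M * Real.sqrt (∫ x, ‖Literature.Analysis.FluidPDE.curl v x‖ ^ 2) *
          Real.sqrt (∫ x, Literature.Analysis.FluidPDE.frobeniusNormSq (fderiv ℝ (Literature.Analysis.FluidPDE.curl v) x))}) ^ 2 * M ^ 2 * (eg * A1 v (curl η) + C1 v (curl η))

/-- **stub 2a «PATHWISE EL OFF THE CONTACT SET» (rank 2, size L; plausibly TRUE).**  For an EXTREMAL Campbell law (`IsCampbellExtremal`: efficiency ≥ κ⋆ at speed bound M, = κ⋆ by no-gain),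
P-a.e. realisation satisfies the Euler–Lagrange identity off its contact set with the law's constants.  Route: no-gain (`stub_noGainFromLaws`)
bounds the efficiency of every admissible law by κ⋆; the re-twisted deformed laws (`stub_campbellLaw_deform`) along bounded smooth local
shift-equivariant divergence-free directions `F = curl[Φ(θ_x v) η(θ_x v)]` vanishing on configurations with `‖v(0)‖ ≥ M − δ` are admissible with the
SAME M (sup-preservation, the random `norm_add_smul_le_of_tsupport_subset`), so the first variation of `(E f)²/(M² E g)` (in the un-normalised
Palm quantities A_ε, B_ε, C_ε it is the deterministic `J²/(M²ZW)` form) vanishes; localising Φ in configuration space and using the Campbell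
identity turns the law-level identity into the pathwise one at a.e. realisation.  Why it might fail: differentiation under E needs the uniform Bk
bounds and integrability (assumed); otherwise classical. [sources: tree `KStar.firstVariation_eq_zero_offContact` (deterministic version);
LastPenrose2017 Ch. 9; Kallenberg2021] -/
theorem stub_pathwiseEL :
    ∀ (Ω : Type) (_ : MeasurableSpace Ω) (P : Measure Ω)
      (V : Ω → EuclideanSpace ℝ (Fin 3) → EuclideanSpace ℝ (Fin 3)) (M : ℝ),
      IsCampbellExtremal P V M →
        ∀ᵐ w ∂P, PathwiseEL (V w) M (∫ w, ⟪curl (V w) 0, fderiv ℝ (V w) 0 (curl (V w) 0)⟫_ℝ / ‖curl (V w) 0‖ ^ 2 ∂P)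
          (∫ w, frobeniusNormSq (fderiv ℝ (curl (V w)) 0) / ‖curl (V w) 0‖ ^ 2 ∂P) {x | ‖V w x‖ < M} := by
  sorry

/-- **S2b «DENSITY EXTENSION» — PROVED (rev 3.3), per realisation, by the tree's `KStar.exists_density` continuity argument.**  If the contact set
`{‖v‖ = M}` has empty interior, the pathwise EL identity off the contact set extends to ALL test fields: the functional
`η ↦ ef·J₁(curl η) − κ⋆²M²(eg·a₁(curl η) + c₁(curl η))` has a continuous density `G` (`exists_density`), which vanishes on the dense open set
`{‖v‖ < M}`, hence everywhere (curl form suffices downstream: the cut-off `φ_R` of S2c is a curl). [sources: tree `KStar.exists_density`,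
`interior_contact_nonempty` (proof, step «hence everywhere by continuity», copied)] -/
theorem densityExtension
    (v : EuclideanSpace ℝ (Fin 3) → EuclideanSpace ℝ (Fin 3)) (M ef eg : ℝ) (hv : ContDiff ℝ ∞ v)
    (hEL : PathwiseEL v M ef eg {x | ‖v x‖ < M}) (hint : interior {x | ‖v x‖ = M} = ∅) (hM : ∀ x, ‖v x‖ ≤ M) :
    PathwiseEL v M ef eg Set.univ := by
  intro η hη hηc _
  have hne : Dense {x | ‖v x‖ < M} := by
    rw [interior_eq_empty_iff_dense_compl] at hint
    have hUeq : ({x | ‖v x‖ = M} : Set (EuclideanSpace ℝ (Fin 3)))ᶜ = {x | ‖v x‖ < M} := by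
      ext x
      simp only [mem_compl_iff, mem_setOf_eq]
      exact ⟨fun h => lt_of_le_of_ne (hM x) h, fun h => ne_of_lt h⟩
    rwa [hUeq] at hint
  have hUo : IsOpen {x | ‖v x‖ < M} := isOpen_lt (continuous_norm.comp hv.continuous) continuous_const
  -- the continuous density of the functional on curls (tree: `KStar.exists_density`)
  obtain ⟨G, hGc, hG⟩ := Theorems.DepletionLadder.KStar.exists_density hv ef
    (-((sInf {κ : ℝ | ∀ (v : EuclideanSpace ℝ (Fin 3) → EuclideanSpace ℝ (Fin 3)) (M B : ℝ), ContDiff ℝ (⊤ : ℕ∞) v →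
      Literature.Analysis.FluidPDE.VectorCalculus.IsDivFree v → (∀ x, ‖v x‖ ≤ M) → (∀ x, ‖fderiv ℝ v x‖ ≤ B) →
      (∫⁻ x, ‖iteratedFDeriv ℝ 0 v x‖ₑ ^ 2 < ⊤) → (∫⁻ x, ‖iteratedFDeriv ℝ 1 v x‖ₑ ^ 2 < ⊤) →
      (∫⁻ x, ‖iteratedFDeriv ℝ 2 v x‖ₑ ^ 2 < ⊤) →
      |∫ x, ⟪Literature.Analysis.FluidPDE.curl v x, fderiv ℝ v x (Literature.Analysis.FluidPDE.curl v x)⟫_ℝ| ≤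
        κ * M * Real.sqrt (∫ x, ‖Literature.Analysis.FluidPDE.curl v x‖ ^ 2) *
          Real.sqrt (∫ x, Literature.Analysis.FluidPDE.frobeniusNormSq (fderiv ℝ (Literature.Analysis.FluidPDE.curl v) x))}) ^ 2 * M ^ 2 * eg)) (-((sInf {κ : ℝ | ∀ (v : EuclideanSpace ℝ (Fin 3) → EuclideanSpace ℝ (Fin 3)) (M B : ℝ), ContDiff ℝ (⊤ : ℕ∞) v →
      Literature.Analysis.FluidPDE.VectorCalculus.IsDivFree v → (∀ x, ‖v x‖ ≤ M) → (∀ x, ‖fderiv ℝ v x‖ ≤ B) →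
      (∫⁻ x, ‖iteratedFDeriv ℝ 0 v x‖ₑ ^ 2 < ⊤) → (∫⁻ x, ‖iteratedFDeriv ℝ 1 v x‖ₑ ^ 2 < ⊤) →
      (∫⁻ x, ‖iteratedFDeriv ℝ 2 v x‖ₑ ^ 2 < ⊤) →
      |∫ x, ⟪Literature.Analysis.FluidPDE.curl v x, fderiv ℝ v x (Literature.Analysis.FluidPDE.curl v x)⟫_ℝ| ≤
        κ * M * Real.sqrt (∫ x, ‖Literature.Analysis.FluidPDE.curl v x‖ ^ 2) *
          Real.sqrt (∫ x, Literature.Analysis.FluidPDE.frobeniusNormSq (fderiv ℝ (Literature.Analysis.FluidPDE.curl v) x))}) ^ 2 * M ^ 2))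
  have hℓ : ∀ θ : EuclideanSpace ℝ (Fin 3) → EuclideanSpace ℝ (Fin 3), ContDiff ℝ ∞ θ → HasCompactSupport θ →
      ef * J1 v (curl θ) - (sInf {κ : ℝ | ∀ (v : EuclideanSpace ℝ (Fin 3) → EuclideanSpace ℝ (Fin 3)) (M B : ℝ), ContDiff ℝ (⊤ : ℕ∞) v →
      Literature.Analysis.FluidPDE.VectorCalculus.IsDivFree v → (∀ x, ‖v x‖ ≤ M) → (∀ x, ‖fderiv ℝ v x‖ ≤ B) →
      (∫⁻ x, ‖iteratedFDeriv ℝ 0 v x‖ₑ ^ 2 < ⊤) → (∫⁻ x, ‖iteratedFDeriv ℝ 1 v x‖ₑ ^ 2 < ⊤) →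
      (∫⁻ x, ‖iteratedFDeriv ℝ 2 v x‖ₑ ^ 2 < ⊤) →
      |∫ x, ⟪Literature.Analysis.FluidPDE.curl v x, fderiv ℝ v x (Literature.Analysis.FluidPDE.curl v x)⟫_ℝ| ≤
        κ * M * Real.sqrt (∫ x, ‖Literature.Analysis.FluidPDE.curl v x‖ ^ 2) *
          Real.sqrt (∫ x, Literature.Analysis.FluidPDE.frobeniusNormSq (fderiv ℝ (Literature.Analysis.FluidPDE.curl v) x))}) ^ 2 * M ^ 2 * (eg * A1 v (curl θ) + C1 v (curl θ)) = ∫ x, ⟪G x, θ x⟫ := by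
    intro θ hθ hθc
    rw [← hG θ hθ hθc]
    unfold J1 A1 C1
    ring
  have hℓ0 : ∀ θ : EuclideanSpace ℝ (Fin 3) → EuclideanSpace ℝ (Fin 3), ContDiff ℝ ∞ θ → HasCompactSupport θ →
      tsupport θ ⊆ {x | ‖v x‖ < M} → ∫ x, ⟪G x, θ x⟫ = 0 := by
    intro θ hθ hθc hθU
    rw [← hℓ θ hθ hθc, hEL θ hθ hθc hθU]
    ring
  -- `G = 0` a.e. on `{‖v‖ < M}`, hence on it, hence everywhere (verbatim from the tree proof)
  have hGae : ∀ᵐ x ∂(volume : Measure (EuclideanSpace ℝ (Fin 3))), x ∈ {x | ‖v x‖ < M} → G x = 0 := by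
    refine hUo.ae_eq_zero_of_integral_contDiff_smul_eq_zero (hGc.locallyIntegrable.locallyIntegrableOn _)
      fun θ hθ hθc hθU => ?_
    have hint' : Integrable (fun x => θ x • G x) (volume : Measure (EuclideanSpace ℝ (Fin 3))) :=
      (hθ.continuous.smul hGc).integrable_of_hasCompactSupport hθc.smul_right
    refine ext_inner_left ℝ fun e => ?_
    rw [inner_zero_right, ← integral_inner hint' e]
    have hη' : ContDiff ℝ ∞ fun x => θ x • e := hθ.smul contDiff_const
    have hηc' : HasCompactSupport fun x => θ x • e := hθc.smul_right
    have hηU' : tsupport (fun x => θ x • e) ⊆ {x | ‖v x‖ < M} := (tsupport_smul_subset_left _ _).trans hθU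
    have hpt : ∀ x, ⟪e, θ x • G x⟫ = ⟪G x, θ x • e⟫ := fun x => by
      rw [inner_smul_right, inner_smul_right, real_inner_comm]
    rw [integral_congr_ae (Eventually.of_forall hpt)]
    exact hℓ0 _ hη' hηc' hηU'
  have hGU : EqOn G 0 {x | ‖v x‖ < M} :=
    Measure.eqOn_open_of_ae_eq ((ae_restrict_iff' hUo.measurableSet).2 hGae) hUo hGc.continuousOn
      continuousOn_const
  have hG0 : G = 0 := Continuous.ext_on hne hGc continuous_const hGU
  have h := hℓ η hη hηc
  rw [hG0] at h
  simp only [Pi.zero_apply, inner_zero_left, integral_zero] at h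
  linarith

-- rev 3.7: S2c is SPLIT into its analytic core `stub_cutoffAveraging` (the averaged cut-off identity) and the elementary contradiction
-- `homogeneityContradiction` (PROVED below from `κ⋆ > 13/200`, the extremality inequality and `E g > 0`).  NO ergodicity hypothesis (V42 P7: such a
-- clause is vacuous on the product σ-algebra, and it is not needed: the pathwise identity tested against the cut-off, divided by `Z_R`, has an R → ∞
-- limit given by CONDITIONAL expectations on the invariant σ-algebra; the relation is linear in them, so taking expectation gives the identity for
-- the law itself).
/-- **stub 2c «CUT-OFF AVERAGING» (rank 2, size M/L; plausibly TRUE, residual risk = THIN laws).**  For a twisted-stationary extremal slice law whose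
realisations satisfy, a.s., the Euler–Lagrange identity `PathwiseEL … univ` with the law's constants `ef = E f`, `eg = E g` for ALL curls (hence, by the
tree's `DivFreeVectorPotential`, for all smooth compactly supported divergence-free test fields), the identity AVERAGES to `3·(E f)² = 2·κ⋆²·M²·(E g)`.
ROUTE (rev 3.7, replacing the cone-potential cut-off, whose full gradient grows like R·‖Dv‖ and spoils the annulus terms in the stationary setting):
(1) PALM-NORMALISED CUT-OFF: test with `φ_R = χ̃_R·v − w_R`, where `χ̃_R(x) := χ(x/R) / Y_R(θ_x v)` is the fat radial cut-off divided by the REALISATION's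
|ω|²-mass of the R-ball AROUND x (`Y_R(η) := ∫ χ(a/R)|curl η(a)|² da`), and `w_R` is the Bogovskiĭ correction on the annulus solving `div w_R = ∇χ̃_R·v`
(mean zero because `div v = 0`; smooth, supported in the annulus, `‖D^k w_R‖₂ ≤ C·‖D^(k−1)(∇χ̃_R·v)‖₂` with a SCALE-INVARIANT constant — Galdi2011
Lemma III.3.1/Thm III.3.3, arXiv:1811.00507 Lemma «Bogovskiĭ»); (2) EXACT EXPECTATIONS by the integrated Campbell identity (first lemma
`stub_campbellFubini` in the el file = the Mecke/Neveu exchange formula): `E[3∫χ̃_R⟨ω,Dv ω⟩] = 3·E f`, `E[∫χ̃_R|ω|²] = 1`, `E[∫χ̃_R|∇ω|²] = E g` for EVERY R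
— no ergodicity, no limits in the main terms; (3) ERROR TERMS (all terms carrying `∇χ̃_R ~ χ̃_R/R` or `w_R`) are `≤ C(M, B₁, B₂)·R²·sup_(x ∈ B_2R) 1/Y_R(θ_x v)`
pathwise by the a.s. derivative bounds of `IsCampbellExtremal`, so they vanish in expectation as R → ∞ iff the law is NOT THIN: `E[R² · sup_(B_2R) 1/Y_R(θ_x ·)]
→ 0` (ball masses ≫ R²; automatic for laws of positive |ω|²-intensity in volume sense).  WHY IT MIGHT FAIL: THIN extremal laws — |ω|² carried by
filaments/sheets with `Y_R = O(R²)` — for which step (3) fails; the bet (separately checkable) is that thin twisted-stationary laws have efficiency < κ⋆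
(a straight tube has ω·Sω ≡ 0).  [sources: tree `KStar.interior_contact_nonempty` (deterministic twin `ℓ(φ) = κ⋆²M²ZW` with φ = v), `DivFreeVectorPotential`;
Galdi2011 §III.3; arXiv:1811.00507 p.7; LastPenrose2017 §9 (Mecke / exchange formula); Kallenberg2021 Ch. 30] -/
theorem stub_cutoffAveraging :
    ∀ (Ω : Type) (_ : MeasurableSpace Ω) (P : Measure Ω)
      (V : Ω → EuclideanSpace ℝ (Fin 3) → EuclideanSpace ℝ (Fin 3)) (M : ℝ),
      IsCampbellExtremal P V M →
      (∀ᵐ w ∂P, PathwiseEL (V w) M (∫ w, ⟪curl (V w) 0, fderiv ℝ (V w) 0 (curl (V w) 0)⟫_ℝ / ‖curl (V w) 0‖ ^ 2 ∂P)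
          (∫ w, frobeniusNormSq (fderiv ℝ (curl (V w)) 0) / ‖curl (V w) 0‖ ^ 2 ∂P) Set.univ) →
        3 * (∫ w, ⟪curl (V w) 0, fderiv ℝ (V w) 0 (curl (V w) 0)⟫_ℝ / ‖curl (V w) 0‖ ^ 2 ∂P) ^ 2 =
          2 * (sInf {κ : ℝ | ∀ (v : EuclideanSpace ℝ (Fin 3) → EuclideanSpace ℝ (Fin 3)) (M B : ℝ), ContDiff ℝ (⊤ : ℕ∞) v →
      Literature.Analysis.FluidPDE.VectorCalculus.IsDivFree v → (∀ x, ‖v x‖ ≤ M) → (∀ x, ‖fderiv ℝ v x‖ ≤ B) →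
      (∫⁻ x, ‖iteratedFDeriv ℝ 0 v x‖ₑ ^ 2 < ⊤) → (∫⁻ x, ‖iteratedFDeriv ℝ 1 v x‖ₑ ^ 2 < ⊤) →
      (∫⁻ x, ‖iteratedFDeriv ℝ 2 v x‖ₑ ^ 2 < ⊤) →
      |∫ x, ⟪Literature.Analysis.FluidPDE.curl v x, fderiv ℝ v x (Literature.Analysis.FluidPDE.curl v x)⟫_ℝ| ≤
        κ * M * Real.sqrt (∫ x, ‖Literature.Analysis.FluidPDE.curl v x‖ ^ 2) *
          Real.sqrt (∫ x, Literature.Analysis.FluidPDE.frobeniusNormSq (fderiv ℝ (Literature.Analysis.FluidPDE.curl v) x))}) ^ 2 * M ^ 2 *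
            (∫ w, frobeniusNormSq (fderiv ℝ (curl (V w)) 0) / ‖curl (V w) 0‖ ^ 2 ∂P) := by
  sorry

/-- **S2c «HOMOGENEITY CONTRADICTION» — PROVED (rev 3.7) from `stub_cutoffAveraging`:** an extremal slice law (`κ⋆·M·√(E g) ≤ |E f|`, `E g > 0`,
`M > 0`, and `κ⋆ > 13/200` by the tree's `DepletionLadder.sharpDepletion_gt`) cannot satisfy `3(E f)² = 2κ⋆²M²(E g)`: the two give `3(E f)² ≤ 2(E f)²`,
so `E f = 0`, so `κ⋆M√(E g) ≤ 0`, absurd. -/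
theorem homogeneityContradiction :
    ∀ (Ω : Type) (_ : MeasurableSpace Ω) (P : Measure Ω)
      (V : Ω → EuclideanSpace ℝ (Fin 3) → EuclideanSpace ℝ (Fin 3)) (M : ℝ),
      IsCampbellExtremal P V M →
      (∀ᵐ w ∂P, PathwiseEL (V w) M (∫ w, ⟪curl (V w) 0, fderiv ℝ (V w) 0 (curl (V w) 0)⟫_ℝ / ‖curl (V w) 0‖ ^ 2 ∂P)
          (∫ w, frobeniusNormSq (fderiv ℝ (curl (V w)) 0) / ‖curl (V w) 0‖ ^ 2 ∂P) Set.univ) →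
        False := by
  intro Ω mΩ P V M hext hEL
  have havg := stub_cutoffAveraging Ω mΩ P V M hext hEL
  obtain ⟨-, hM, -, -, -, -, -, -, -, -, -, hgpos, heff⟩ := hext
  have hκ : (0 : ℝ) < (sInf {κ : ℝ | ∀ (v : EuclideanSpace ℝ (Fin 3) → EuclideanSpace ℝ (Fin 3)) (M B : ℝ), ContDiff ℝ (⊤ : ℕ∞) v →
      Literature.Analysis.FluidPDE.VectorCalculus.IsDivFree v → (∀ x, ‖v x‖ ≤ M) → (∀ x, ‖fderiv ℝ v x‖ ≤ B) →
      (∫⁻ x, ‖iteratedFDeriv ℝ 0 v x‖ₑ ^ 2 < ⊤) → (∫⁻ x, ‖iteratedFDeriv ℝ 1 v x‖ₑ ^ 2 < ⊤) →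
      (∫⁻ x, ‖iteratedFDeriv ℝ 2 v x‖ₑ ^ 2 < ⊤) →
      |∫ x, ⟪Literature.Analysis.FluidPDE.curl v x, fderiv ℝ v x (Literature.Analysis.FluidPDE.curl v x)⟫_ℝ| ≤
        κ * M * Real.sqrt (∫ x, ‖Literature.Analysis.FluidPDE.curl v x‖ ^ 2) *
          Real.sqrt (∫ x, Literature.Analysis.FluidPDE.frobeniusNormSq (fderiv ℝ (Literature.Analysis.FluidPDE.curl v) x))}) :=
    lt_trans (by norm_num) Theorems.DepletionLadder.sharpDepletion_gt
  have h1 : 0 < (sInf {κ : ℝ | ∀ (v : EuclideanSpace ℝ (Fin 3) → EuclideanSpace ℝ (Fin 3)) (M B : ℝ), ContDiff ℝ (⊤ : ℕ∞) v →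
      Literature.Analysis.FluidPDE.VectorCalculus.IsDivFree v → (∀ x, ‖v x‖ ≤ M) → (∀ x, ‖fderiv ℝ v x‖ ≤ B) →
      (∫⁻ x, ‖iteratedFDeriv ℝ 0 v x‖ₑ ^ 2 < ⊤) → (∫⁻ x, ‖iteratedFDeriv ℝ 1 v x‖ₑ ^ 2 < ⊤) →
      (∫⁻ x, ‖iteratedFDeriv ℝ 2 v x‖ₑ ^ 2 < ⊤) →
      |∫ x, ⟪Literature.Analysis.FluidPDE.curl v x, fderiv ℝ v x (Literature.Analysis.FluidPDE.curl v x)⟫_ℝ| ≤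
        κ * M * Real.sqrt (∫ x, ‖Literature.Analysis.FluidPDE.curl v x‖ ^ 2) *
          Real.sqrt (∫ x, Literature.Analysis.FluidPDE.frobeniusNormSq (fderiv ℝ (Literature.Analysis.FluidPDE.curl v) x))}) * M *
      Real.sqrt (∫ w, frobeniusNormSq (fderiv ℝ (curl (V w)) 0) / ‖curl (V w) 0‖ ^ 2 ∂P) :=
    mul_pos (mul_pos hκ hM) (Real.sqrt_pos.mpr hgpos)
  have h2 := pow_le_pow_left₀ h1.le heff 2
  rw [sq_abs, mul_pow, mul_pow, Real.sq_sqrt hgpos.le] at h2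
  nlinarith [h1, h2, havg, mul_pos (mul_pos (pow_pos hκ 2) (pow_pos hM 2)) hgpos]

/-- **S2′ SLICE CONTACT — now a THEOREM of S2a, S2b, S2c (rev 3.4; it was the stub `stub_sliceContact` in rev 3.2/3.3; rev 3.6: stated for pre-window laws).**  Under a
window-extremal law, with positive probability the realisation has, at some time of the window, an exact top-speed plateau of positive volume at a positive level
bounding the slice.  Proof: take an extremal time τ ∈ E with slice law `P_τ ≪ P`, amplitude `M_τ > 0`; if the plateau event were P-null it would be
`P_τ`-null; `P_τ`-a.s. `‖𝒲 w τ‖ ≤ M_τ`, so `P_τ`-a.s. the contact set is Lebesgue-null, hence has empty interior (open sets have positive volume);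
S2a + S2b give `P_τ`-a.s. the Euler–Lagrange identity for all curls; S2c. -/
theorem sliceContact :
    ∀ (Ω : Type) (_ : MeasurableSpace Ω) (P : Measure Ω)
      (𝒲 : Ω → ℝ → EuclideanSpace ℝ (Fin 3) → EuclideanSpace ℝ (Fin 3)) (τ₀ a b : ℝ),
      IsPreWindowLaw P 𝒲 τ₀ a b →
        0 < P {w | ∃ t₀ ∈ Set.Ioo a b, ∃ m : ℝ, 0 < m ∧ (∀ y, ‖𝒲 w t₀ y‖ ≤ m) ∧
          0 < volume {y : EuclideanSpace ℝ (Fin 3) | ‖𝒲 w t₀ y‖ = m}} := by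
  intro Ω mΩ P 𝒲 τ₀ a b hL
  obtain ⟨hprob, hab, hb0, hτ₀, hmeas, hae, hwt, hcamp, E, hEsub, hEpos, hwin⟩ := hL
  obtain ⟨τ, hτE⟩ := nonempty_of_measure_ne_zero hEpos.ne'
  obtain ⟨Pτ, Mτ, hac, hext⟩ := hwin τ hτE
  have hτab : τ ∈ Set.Ioo a b := hEsub hτE
  have hext' := hext
  obtain ⟨hprobτ, hMτ, hmeasV, hmeasU, haeτ, hamp, hBk, hwt, hcamp, hintf, hintg, hgpos, heff⟩ := hext'
  by_contra hzero
  have hP0 : P {w | ∃ t₀ ∈ Set.Ioo a b, ∃ m : ℝ, 0 < m ∧ (∀ y, ‖𝒲 w t₀ y‖ ≤ m) ∧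
      0 < volume {y : EuclideanSpace ℝ (Fin 3) | ‖𝒲 w t₀ y‖ = m}} = 0 :=
    le_antisymm (not_lt.mp hzero) bot_le
  have hPτ0 : Pτ {w | ∃ t₀ ∈ Set.Ioo a b, ∃ m : ℝ, 0 < m ∧ (∀ y, ‖𝒲 w t₀ y‖ ≤ m) ∧
      0 < volume {y : EuclideanSpace ℝ (Fin 3) | ‖𝒲 w t₀ y‖ = m}} = 0 := hac hP0
  have hnot : ∀ᵐ w ∂Pτ, ¬ (∃ t₀ ∈ Set.Ioo a b, ∃ m : ℝ, 0 < m ∧ (∀ y, ‖𝒲 w t₀ y‖ ≤ m) ∧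
      0 < volume {y : EuclideanSpace ℝ (Fin 3) | ‖𝒲 w t₀ y‖ = m}) :=
    (measure_eq_zero_iff_ae_notMem).mp hPτ0
  -- `Pτ`-a.s.: EL for all curls
  have hELall : ∀ᵐ w ∂Pτ, PathwiseEL (𝒲 w τ) Mτ
      (∫ w, ⟪curl (𝒲 w τ) 0, fderiv ℝ (𝒲 w τ) 0 (curl (𝒲 w τ) 0)⟫_ℝ / ‖curl (𝒲 w τ) 0‖ ^ 2 ∂Pτ)
      (∫ w, frobeniusNormSq (fderiv ℝ (curl (𝒲 w τ)) 0) / ‖curl (𝒲 w τ) 0‖ ^ 2 ∂Pτ) Set.univ := by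
    filter_upwards [stub_pathwiseEL Ω mΩ Pτ (fun w => 𝒲 w τ) Mτ hext, haeτ, hnot] with w hEL hw hn
    obtain ⟨hsm, -, hbd, -⟩ := hw
    refine densityExtension (𝒲 w τ) Mτ _ _ hsm hEL ?_ hbd
    -- the contact set has empty interior: otherwise it has positive volume and the plateau event holds at (τ, Mτ)
    by_contra hne
    apply hn
    refine ⟨τ, hτab, Mτ, hMτ, hbd, ?_⟩
    obtain ⟨x, hx⟩ := Set.nonempty_iff_ne_empty.mpr hne
    exact lt_of_lt_of_le (isOpen_interior.measure_pos volume ⟨x, hx⟩) (measure_mono interior_subset)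
  exact homogeneityContradiction Ω mΩ Pτ (fun w => 𝒲 w τ) Mτ hext hELall

/-- **stub 3′ (= route item stmt-NavierStokesRegularity-27823 `PlateauSliceRigidity`, cited BY NAME — the neighbour's (ns-idea-5, LINE g5-α repair)
rigidity child of 27677; rank 3 here; classical mathematics with a typed proof route in its docstring: slice analyticity (tree
`typeI_mild_slice_analytic`) ⇒ constant speed m on ℝ³ at t₀ (`realAnalytic_zeroSet_null_holds`) ⇒ ∫_{B_ρ}‖W t₀‖² = (4π/3)m²ρ³, against the LOCAL
ENERGY BUDGET ∫_{B_ρ}‖W(t)‖² ≤ C(K)ρ²/√(−t) of Type-I Oseen-mild ancient fields).**  When 27823 is proved in Theorems this stub closes by name.  It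
IMPLIES the rev ≤ 3 end-game 27678 (`plateauAncientRigidity_of_slice` below, proved). [sources: Theses.ExtremiserTransience items 27823/27678;
KochNadirashviliSereginSverak2009] -/
theorem stub_plateauSliceRigidity : PlateauSliceRigidity := by
  sorry

/-- Cross-check (proved): the neighbour's slice rigidity (27823) implies the rev ≤ 3 end-game `PlateauAncientRigidity` (27678) — pick one time in the
positive-measure set; `m > 0` because a slice with non-zero curl is not identically zero (`curl_zero`). [folklore] -/
theorem plateauAncientRigidity_of_slice (hS : PlateauSliceRigidity) : PlateauAncientRigidity := by
  rintro ⟨W, K, a, b, ⟨hK, hO⟩, hdec, hab, hb0, hvol⟩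
  obtain ⟨t, ht⟩ := nonempty_of_measure_ne_zero hvol.ne'
  obtain ⟨htab, ⟨M, hbd, hvolM⟩, x, hx⟩ := ht
  have hM : 0 < M := by
    by_contra hle
    apply hx
    have hzero : W t = 0 := by
      funext y
      exact norm_le_zero_iff.mp ((hbd y).trans (not_lt.mp hle))
    rw [hzero]
    exact curl_zero x
  exact hS ⟨W, K, t, M, hK.smooth.continuousOn, hO, hdec, htab.2.trans_le hb0, hM, hbd, hvolM⟩

/-- GLUE (proved): a pre-window law with the slice-contact event of positive probability yields the slice object excluded by
`PlateauSliceRigidity` (27823): realisations are a.s. smooth on (−∞,0)×ℝ³ (⇒ continuous) with the Oseen identity and a backward Type-I bound —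
no sup-normalisation is asked (rev 3.6). [folklore] -/
theorem sliceElement_of_window
    {Ω : Type} [MeasurableSpace Ω] {P : Measure Ω}
    {𝒲 : Ω → ℝ → EuclideanSpace ℝ (Fin 3) → EuclideanSpace ℝ (Fin 3)} {τ₀ a b : ℝ}
    (hL : IsPreWindowLaw P 𝒲 τ₀ a b)
    (hpos : 0 < P {w | ∃ t₀ ∈ Set.Ioo a b, ∃ m : ℝ, 0 < m ∧ (∀ y, ‖𝒲 w t₀ y‖ ≤ m) ∧
          0 < volume {y : EuclideanSpace ℝ (Fin 3) | ‖𝒲 w t₀ y‖ = m}}) :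
    ∃ (W : ℝ → EuclideanSpace ℝ (Fin 3) → EuclideanSpace ℝ (Fin 3)) (K t₀ m : ℝ),
      ContinuousOn (Function.uncurry W) (Set.Iio (0 : ℝ) ×ˢ Set.univ) ∧
      (∀ s t : ℝ, s < t → t < 0 → ∀ x, W t x = heatFlow (W s) (t - s) x - oseenDuhamel 1 s W W t x) ∧
      (∀ t : ℝ, t < 0 → ∀ x, Real.sqrt (-t) * ‖W t x‖ ≤ K) ∧ t₀ < 0 ∧ 0 < m ∧ (∀ y, ‖W t₀ y‖ ≤ m) ∧
      0 < volume {y : EuclideanSpace ℝ (Fin 3) | ‖W t₀ y‖ = m} := by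
  obtain ⟨hprob, hab, hb0, hτ₀, hmeas, hae, hwt, hcamp, hwin⟩ := hL
  by_contra hnone
  apply hpos.ne'
  rw [measure_eq_zero_iff_ae_notMem]
  filter_upwards [hae] with w hw hmem
  obtain ⟨-, -, hsm, hO, ⟨K, hdec⟩, -⟩ := hw
  obtain ⟨t₀, ht₀, m, hm, hbd, hvol⟩ := hmem
  exact hnone ⟨𝒲 w, K, t₀, m, hsm.continuousOn, hO, hdec, ht₀.2.trans_le hb0, hm, hbd, hvol⟩

/-- **COMPOSITION (kernel-checked, no sorry): S1a (pre-window law) + S2′ (= S2a + S2b + S2c, proved here) + glue + S3′ (27823) ⟹ `NearExtremalTransiencePerFlow` (stmt-26567) BY NAME.** [folklore] -/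
theorem NearExtremalTransiencePerFlow_of : NearExtremalTransiencePerFlow := by
  intro C ν T hC hν hT u p hsol hLH hdec hrate hext
  by_contra hcon
  obtain ⟨Ω, mΩ, P, 𝒲, τ₀, a, b, hL⟩ := stub_preLawExtraction C ν T hC hν hT u p hsol hLH hdec hrate hext hcon
  have hpos := sliceContact Ω mΩ P 𝒲 τ₀ a b hL
  obtain ⟨W, K, t₀, m, h⟩ := sliceElement_of_window hL hpos
  exact stub_plateauSliceRigidity ⟨W, K, t₀, m, h⟩


end Summit.NavierStokesRegularity.NavierStokesRegularity.Cruxes.NearExtremalTransience.CampbellExtremiser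

end
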